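import Summits.ResolutionOfSingularities.ResolutionOfSingularities.Theorems.EquisingularLiftEquisingularLiftCentreBlowupSpecialFibreIntegral
import Summits.ResolutionOfSingularities.ResolutionOfSingularities.Theorems.EquisingularLiftEquisingularLiftGoodAtOfSmooth
import Literature.AlgebraicGeometry.Resolution.RegularBlowup
import Literature.AlgebraicGeometry.Resolution.BlowupsProperProofs
import HarnessLib

/-!
# `EquisingularLift` (stmt-ResolutionOfSingularities-15660), line `Sketch` v8 — the STRUCTURAL stub
# `stub_chain_of_horizChain` (upper sandwich: horizontal regular-centre chains are EL-chains with irreducible special fibre)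

[OURS · L1 W4.5b] Registered stub of the crux skeleton (lead `res-L1-w45b-lead-1`, 2026-08-26). NOT a statement of
any manuscript.

Setting: `O` a discrete valuation ring with closed point `s₀` and residue field `κ`; `q : P → Spec O` smooth and
proper with INTEGRAL scheme-theoretic special fibre `P ×_{Spec O} Spec κ`; `Y ⊆ P` closed; `(P', σ, S')` reached from
`(P, 𝟙, Y)` by finitely many blow-ups `τ : X'' → X'` in centres `C` such that `V(C)` is regular, FLAT over `Spec O`
(horizontal), misses at least one point of the special fibre of `X'`, and maps into the non-generic points of `Y`
(the induction principle "HorizChain", inlined in the signature). CLAIM: `(P', σ, S')` is reached by an EL-admissible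
chain (the fifth conjunct of `EquisingularLift`, which forgets flatness and the missed point) AND the special fibre
`(σ ≫ q)⁻¹(s₀)` of `P'` is irreducible.

Proof. The first conjunct is formal (a class of triples closed under all regular-centre blow-ups is closed under the
horizontal ones). For the second, run the induction principle with the motive
"`X'` locally Noetherian ∧ `X'` regular ∧ `X' ×_{Spec O} Spec κ` integral": the base holds because a smooth
`O`-scheme is locally Noetherian (locally of finite type over the Noetherian `Spec O`) and regular
(`stub_goodAtOfSmooth`, EGA IV 17.5.8 (iii)); the step is Liu Thm. 8.1.19 (a) (`IsBlowup.isRegular_of_isRegular_subscheme`),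
properness of blow-ups (`IsBlowup.isProper`, hence locally Noetherian again) and the landed one-step lemma
`isIntegral_specialFibre_of_isBlowup_regularCentre` (p461776: flat exceptional divisor, Liu 8.1.19 (b); base change of
the blow-up to the special fibre, Stacks 0805; integrality of blow-ups, Stacks 02ND). An integral scheme-theoretic
special fibre has irreducible underlying set (`isIrreducible_preimage_closedPoint`).
-/

set_option linter.dupNamespace false -- mandated namespace `Summit.<Summit>.<Problem>` of this single-conjunct summit
set_option linter.overlappingInstances false -- the registered signature carries `[IsDomain O] [IsDiscreteValuationRing O]`

noncomputable section

open CategoryTheory CategoryTheory.Limits AlgebraicGeometry TopologicalSpace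
open Literature.AlgebraicGeometry.Resolution

namespace Summit.ResolutionOfSingularities.ResolutionOfSingularities.Cruxes.EquisingularLift.StrataSplit

/-- **STUB `stub_chain_of_horizChain`** (STRUCTURAL; lead). For a DVR `O`, a smooth proper `q : P → Spec O` whose
scheme-theoretic special fibre `P ×_O k` is integral, and `(P', σ, S')` reached from `(P, 𝟙, Y)` by finitely many blow-ups
in REGULAR centres `C` that are FLAT over `O` (horizontal), miss at least one point of the running special fibre, and lie
over non-generic points of `Y` (the inlined induction principle "`HorizChain`"): then `(P', σ, S')` is reached by an
EL-admissible chain (verbatim the fifth conjunct of `EquisingularLift`) AND the special fibre of `P' → Spec O` is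
irreducible. Proof plan: `HorizChain ⇒ Chain` is formal; irreducibility by the induction principle with motive
"locally Noetherian ∧ regular ∧ scheme-theoretic special fibre integral", whose step is the landed
`isIntegral_specialFibre_of_isBlowup_regularCentre` (p461776) with `IsBlowup.isRegular_of_isRegular_subscheme` and
`IsBlowup.isProper`; base from smoothness (`Split.GoodAt` toolkit, p161858). -/
theorem stub_chain_of_horizChain : ∀ (O : Type) [CommRing O] [IsDomain O] [IsDiscreteValuationRing O] (P P' : AlgebraicGeometry.Scheme.{0}) (q : P ⟶ AlgebraicGeometry.Spec (.of O)) (Y : TopologicalSpace.Closeds P) (σ : P' ⟶ P) (S' : Set P'), AlgebraicGeometry.Smooth q → AlgebraicGeometry.IsProper q → AlgebraicGeometry.IsIntegral (CategoryTheory.Limits.pullback q (AlgebraicGeometry.Spec.map (CommRingCat.ofHom (IsLocalRing.residue O)))) → (∀ Q : (∀ X' : AlgebraicGeometry.Scheme.{0}, (X' ⟶ P) → Set X' → Prop), Q P (CategoryTheory.CategoryStruct.id P) (Y : Set P) → (∀ (X' X'' : AlgebraicGeometry.Scheme.{0}) (σ' : X' ⟶ P) (Y' : Set X') (C : X'.IdealSheafData)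 (τ : X'' ⟶ X'), Q X' σ' Y' → Literature.AlgebraicGeometry.Resolution.IsBlowup τ C → Literature.AlgebraicGeometry.Resolution.Scheme.IsRegular C.subscheme → AlgebraicGeometry.Flat (CategoryTheory.CategoryStruct.comp C.subschemeι (CategoryTheory.CategoryStruct.comp σ' q)) → (∃ x : X', (CategoryTheory.CategoryStruct.comp σ' q) x = IsLocalRing.closedPoint O ∧ x ∉ (C.support : Set X')) → σ' '' (C.support : Set X') ⊆ {x : P | ¬ IsGenericPoint x (Y : Set P)} → Q X'' (CategoryTheory.CategoryStruct.comp τ σ') (closure (τ ⁻¹' (Y' \ (C.support : Set X'))))) → Q P' σ S') → (∀ Q : (∀ X' : AlgebraicGeometry.Scheme.{0}, (X' ⟶ P) → Set X' → Prop), Q P (CategoryTheory.CategoryStruct.id P) (Y : Set P) → (∀ (X' X'' : AlgebraicGeometry.Scheme.{0}) (σ' : X' ⟶ P) (Y' : Set X') (C : X'.IdealSheafData) (τ : X'' ⟶ X'), Q X' σ' Y' → Literature.AlgebraicGeometry.Resolution.IsBlowup τ C → Literature.AlgebraicGeometry.Resolution.Scheme.IsRegular C.subscheme → σ' '' (C.support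 : Set X') ⊆ {x : P | ¬ IsGenericPoint x (Y : Set P)} → Q X'' (CategoryTheory.CategoryStruct.comp τ σ') (closure (τ ⁻¹' (Y' \ (C.support : Set X'))))) → Q P' σ S') ∧ IsIrreducible ((CategoryTheory.CategoryStruct.comp σ q) ⁻¹' {IsLocalRing.closedPoint O}) := by
  intro O _ _ _ P P' q Y σ S' hsm hpr hint hH
  refine ⟨?_, ?_⟩
  · -- `HorizChain ⇒ Chain`: closure under all regular-centre steps implies closure under horizontal ones
    intro Q h0 hstep
    exact hH Q h0 (fun X' X'' σ' Y' C τ hQ hτ hC _ _ himg => hstep X' X'' σ' Y' C τ hQ hτ hC himg)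
  · -- irreducibility of the final special fibre, by induction with the motive below
    have hN : IsLocallyNoetherian P := by
      haveI := hsm
      exact LocallyOfFiniteType.isLocallyNoetherian q
    have hR : Scheme.IsRegular P := fun y => (stub_goodAtOfSmooth O P q hsm y).1
    have hint₀ : IsIntegral (pullback (𝟙 P ≫ q) (Spec.map (CommRingCat.ofHom (IsLocalRing.residue O)))) := by
      simpa only [Category.id_comp] using hint
    have key := hH (fun X' σ' _ => IsLocallyNoetherian X' ∧ Scheme.IsRegular X' ∧
        IsIntegral (pullback (σ' ≫ q) (Spec.map (CommRingCat.ofHom (IsLocalRing.residue O)))))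
      ⟨hN, hR, hint₀⟩ ?_
    · obtain ⟨_, _, hI⟩ := key
      haveI := hI
      exact isIrreducible_preimage_closedPoint O P' (σ ≫ q)
    · intro X' X'' σ' Y' C τ hQ hτ hC hflat hx _
      obtain ⟨hN', hR', hI'⟩ := hQ
      haveI := hN'
      haveI : IsProper τ := hτ.isProper
      refine ⟨LocallyOfFiniteType.isLocallyNoetherian τ, hτ.isRegular_of_isRegular_subscheme hR' hC, ?_⟩
      have h := isIntegral_specialFibre_of_isBlowup_regularCentre O X' X'' (σ' ≫ q) C hR' hC hflat τ hτ hI' hx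
      simpa only [Category.assoc] using h.1

end Summit.ResolutionOfSingularities.ResolutionOfSingularities.Cruxes.EquisingularLift.StrataSplit

end
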